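import Mathlib
import Literature.NumberTheory.LFunctions.Zhang2022.TypedAppendixB
import Literature.NumberTheory.LFunctions.Zhang2022.AppendixBVarrhoB2
import Literature.NumberTheory.LFunctions.Zhang2022.AppendixBTailB3Transition
import HarnessLib

/-!
# Zhang (2022), Appendix B, proof of (B.3): the termwise comparison of the tail with the smoothed series

Topic `Literature/NumberTheory/LFunctions/Zhang2022` (Landau–Siegel audit tree; verdict-neutral).
Y. Zhang, *Discrete mean estimates and the Landau–Siegel zero*, arXiv:2211.02515v1 (2022)
[Zhang2022LandauSiegel] — **an unrefereed manuscript under adjudication**; nothing here asserts or denies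
its Theorems 1–2. Appendix B p. 108 (tex L5322, DAG `Z22:§B.u013`). For `y = l₁l` the term of
`Typed.AppendixB.seriesB13` is `f(l) = ϱ_j(l)/l·(P₁/y)^{β₆}·(1/0.504)∫_{0.5}^{0.504}(g(P^z/y) − g(P^{0.5}/y))dz`
and that of `Typed.AppendixB.tailB3` is `g(l) = 1[P^{1/2}/l₁ < l]ϰ₁(l₁l)ϱ_j(l)/l`. This file proves
(`u013_term_bound`): `‖f(l) − g(l)‖ ≤ 2‖ϱ_j(l)‖/l` on the window `P^{1/2}/(el₁) < l ≤ eP^{1/2}/l₁`,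
`≤ c_O‖ϱ_j(l)‖/l` with `c_O = (1/0.504)(½√(π/Λ)/log P + 0.002e^{−Λ})` off the window with `l₁l < P`
(there the main terms AGREE: `vk1_eq_weight`, the amplitude of `ϰ₁` is the averaged sharp weight), and
`≤ (0.004/0.504)P^{−1/2}l^{−3/2}` for `l₁l ≥ P`. Summed in `AppendixBTailB3U013`.
No claim about Lemma 15.1, Theorems 1–2 of the source or about Landau–Siegel zeros is made.
-/

noncomputable section

open Complex Real Finset MeasureTheory Set

namespace Literature.NumberTheory.LFunctions.Zhang2022.AppendixBVarrho

open Literature.NumberTheory.LFunctions Literature.NumberTheory.LFunctions.Zhang2022 Skeleton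
  Typed.AppendixB GaussWeight MeanSquareMajorant

/-! ## Elementary facts -/

/-- `(β₆).re = 0` (`β₆ = 3iα/2`). [cite: Zhang2022LandauSiegel, §2 (2.22)] -/
private theorem beta6_re (D : ℕ) : (beta6 D).re = 0 := by
  rw [show beta6 D = ((3 * alpha D / 2 : ℝ) : ℂ) * I by unfold beta6; push_cast; ring]
  simp

/-- `‖(x : ℂ)^{β₆}‖ = 1` for `x > 0`. [cite: Zhang2022LandauSiegel, §8 (8.6)] -/
private theorem norm_cpow_beta6 (D : ℕ) {x : ℝ} (hx : 0 < x) : ‖((x : ℝ) : ℂ) ^ beta6 D‖ = 1 := by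
  rw [Complex.norm_cpow_eq_rpow_re_of_pos hx, beta6_re, Real.rpow_zero]

/-- `‖ϱ_j(l)/l‖ ≤ 1` (`‖ϱ_j(l)‖ ≤ τ₂(l) ≤ l`). [cite: Zhang2022LandauSiegel, App. B p.106] -/
private theorem norm_varrhoJ_div_le_one (c' : ℝ) (D j : ℕ) {l : ℕ} (hl : 0 < l) :
    ‖varrhoJ c' D j l / (l : ℂ)‖ ≤ 1 := by
  have hl0 : (0 : ℝ) < l := by exact_mod_cast hl
  rw [norm_div, Complex.norm_natCast, div_le_one hl0]
  calc ‖varrhoJ c' D j l‖ ≤ (l.divisors.card : ℝ) := norm_varrhoJ_le c' D j l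
    _ ≤ l := by exact_mod_cast Nat.card_divisors_le_self l

/-- `|ϰ₁(n)| ≤ 1` for `n ≥ 1` (`P₁ > 1`). [cite: Zhang2022LandauSiegel, §8 (8.6)] -/
private theorem norm_vk1_le_one (D : ℕ) {n : ℕ} (hn : 1 ≤ n) (hP1 : 1 < Skeleton.P1 D) :
    ‖vk1 D n‖ ≤ 1 := by
  have hn0 : (0 : ℝ) < n := by exact_mod_cast hn
  have hlogn : 0 ≤ Real.log n := Real.log_nonneg (by exact_mod_cast hn)
  have hlogP1 : 0 < Real.log (Skeleton.P1 D) := Real.log_pos hP1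
  unfold vk1
  split_ifs with h
  · have hlt : Real.log n < Real.log (Skeleton.P1 D) := Real.log_lt_log hn0 h
    have h1 : Real.log n / Real.log (Skeleton.P1 D) ≤ 1 := by rw [div_le_one hlogP1]; exact hlt.le
    have h2 : 0 ≤ Real.log n / Real.log (Skeleton.P1 D) := div_nonneg hlogn hlogP1.le
    rw [norm_mul, norm_cpow_beta6 D (div_pos (by linarith) hn0), mul_one, Complex.norm_real,
      Real.norm_eq_abs, abs_le]
    constructor <;> linarith
  · simp

/-! ## The termwise comparison -/

/-- **Off the window, the main terms agree**: for `y = l₁l` with `l ≤ P^{1/2}/(el₁)` or `l > eP^{1/2}/l₁`,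
`1[P^{1/2}/l₁ < l]·ϰ₁(l₁l) = (P₁/y)^{β₆}·(1/0.504)·mainW(P, y)` (`P₁ = P^{0.504}`, (8.6)).
[cite: Zhang2022LandauSiegel, App. B p.108 (proof of (B.3)); §8 (8.6)] -/
private theorem vk1_eq_weight (D l₁ l : ℕ) {P L N y : ℝ} (hPdef : P = bigP D)
    (hlogP' : Real.log P = L) (hL0 : 0 < L) (hP1 : 1 < P) (hl₁ : 1 ≤ l₁) (hl : 0 < l)
    (hy : y = ((l₁ * l : ℕ) : ℝ)) (hN : N = P ^ (0.5 : ℝ) / l₁)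
    (hoff : (l : ℝ) ≤ N / Real.exp 1 ∨ Real.exp 1 * N < l) :
    (if bigP D ^ (1 / 2 : ℝ) / l₁ < (l : ℝ) then vk1 D (l₁ * l) else 0) =
      ((Skeleton.P1 D / y : ℝ) : ℂ) ^ beta6 D * (((1 / 0.504) *
        ((∫ z in (0.5 : ℝ)..0.504, (Ioi (Real.log y / Real.log P)).indicator (fun _ => (1 : ℝ)) z) -
        0.004 * (if y < P ^ (0.5 : ℝ) then 1 else 0)) : ℝ) : ℂ) := by
  have hP0 : 0 < P := by linarith
  have hl₁0 : (0 : ℝ) < l₁ := by exact_mod_cast hl₁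
  have hl0 : (0 : ℝ) < l := by exact_mod_cast hl
  have hyeq : y = (l₁ : ℝ) * l := by rw [hy, Nat.cast_mul]
  have hy0 : 0 < y := by rw [hyeq]; positivity
  have he0 : 0 < Real.exp 1 := Real.exp_pos 1
  have he1 : 1 < Real.exp 1 := by have := Real.exp_one_gt_d9; linarith
  have hsqrt0 : 0 < P ^ (0.5 : ℝ) := Real.rpow_pos_of_pos hP0 _
  have hN0 : 0 < N := by rw [hN]; exact div_pos hsqrt0 hl₁0
  have hNl₁ : (l₁ : ℝ) * N = P ^ (0.5 : ℝ) := by rw [hN]; field_simp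
  have h12 : bigP D ^ (1 / 2 : ℝ) = P ^ (0.5 : ℝ) := by rw [hPdef]; norm_num
  have hP1eq : Skeleton.P1 D = P ^ (0.504 : ℝ) := by rw [hPdef]; rfl
  have hP1pos : 0 < Skeleton.P1 D := by rw [hP1eq]; exact Real.rpow_pos_of_pos hP0 _
  have hlogP1 : Real.log (Skeleton.P1 D) = 0.504 * L := by rw [hP1eq, Real.log_rpow hP0, hlogP']
  rcases hoff with h | h
  · -- below: both vanish
    have hNe' : N / Real.exp 1 < N := by
      rw [div_lt_iff₀ he0]; nlinarith
    have hnot : ¬ (bigP D ^ (1 / 2 : ℝ) / l₁ < (l : ℝ)) := by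
      rw [h12, ← hN, not_lt]; exact le_trans h hNe'.le
    have hyhalf : y < P ^ (0.5 : ℝ) := by
      calc y = (l₁ : ℝ) * l := hyeq
        _ ≤ (l₁ : ℝ) * (N / Real.exp 1) := mul_le_mul_of_nonneg_left h hl₁0.le
        _ < (l₁ : ℝ) * N := mul_lt_mul_of_pos_left hNe' hl₁0
        _ = P ^ (0.5 : ℝ) := hNl₁
    rw [if_neg hnot, mainW_eq_zero_of_lt hP1 hy0 hyhalf]
    simp
  · -- above: `ϰ₁`'s amplitude
    have hNeN : N ≤ Real.exp 1 * N := by nlinarith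
    have hyes : bigP D ^ (1 / 2 : ℝ) / l₁ < (l : ℝ) := by
      rw [h12, ← hN]; exact lt_of_le_of_lt hNeN h
    have hyhalf : P ^ (0.5 : ℝ) < y := by
      calc P ^ (0.5 : ℝ) = (l₁ : ℝ) * N := hNl₁.symm
        _ ≤ (l₁ : ℝ) * (Real.exp 1 * N) := mul_le_mul_of_nonneg_left hNeN hl₁0.le
        _ < (l₁ : ℝ) * l := mul_lt_mul_of_pos_left h hl₁0
        _ = y := hyeq.symm
    rw [if_pos hyes, mainW_eq_of_gt hP1 hyhalf, hlogP']
    unfold vk1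
    rw [← hy, hlogP1]
    split_ifs with hlt
    · have : 0 ≤ 1 - Real.log y / (0.504 * L) := by
        rw [sub_nonneg, div_le_one (by positivity)]
        have := Real.log_lt_log hy0 hlt
        rw [hlogP1] at this
        exact this.le
      rw [max_eq_left this, mul_comm]
    · have : 1 - Real.log y / (0.504 * L) ≤ 0 := by
        rw [sub_nonpos, one_le_div (by positivity)]
        have := Real.log_le_log hP1pos (not_lt.mp hlt)
        rwa [hlogP1] at this
      rw [max_eq_right this]
      simp

/-- Off the window `|log P/2 − log y| ≥ 1` (`y = l₁l`). [cite: Zhang2022LandauSiegel, App. B p.108] -/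
private theorem far_of_off (l₁ l : ℕ) {P L N y : ℝ} (hlogP' : Real.log P = L) (hP1 : 1 < P)
    (hl₁ : 1 ≤ l₁) (hl : 0 < l) (hy : y = ((l₁ * l : ℕ) : ℝ)) (hN : N = P ^ (0.5 : ℝ) / l₁)
    (hoff : (l : ℝ) ≤ N / Real.exp 1 ∨ Real.exp 1 * N < l) :
    1 ≤ |0.5 * Real.log P - Real.log y| := by
  have hP0 : 0 < P := by linarith
  have hl₁0 : (0 : ℝ) < l₁ := by exact_mod_cast hl₁
  have hl0 : (0 : ℝ) < l := by exact_mod_cast hl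
  have hyeq : y = (l₁ : ℝ) * l := by rw [hy, Nat.cast_mul]
  have hy0 : 0 < y := by rw [hyeq]; positivity
  have he0 : 0 < Real.exp 1 := Real.exp_pos 1
  have hsqrt0 : 0 < P ^ (0.5 : ℝ) := Real.rpow_pos_of_pos hP0 _
  have hNl₁ : (l₁ : ℝ) * N = P ^ (0.5 : ℝ) := by rw [hN]; field_simp
  have hlogsqrt : Real.log (P ^ (0.5 : ℝ)) = 0.5 * L := by rw [Real.log_rpow hP0, hlogP']
  rw [hlogP']
  rcases hoff with h | h
  · have hyle : y ≤ P ^ (0.5 : ℝ) / Real.exp 1 := by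
      calc y = (l₁ : ℝ) * l := hyeq
        _ ≤ (l₁ : ℝ) * (N / Real.exp 1) := mul_le_mul_of_nonneg_left h hl₁0.le
        _ = P ^ (0.5 : ℝ) / Real.exp 1 := by rw [← hNl₁]; ring
    have : Real.log y ≤ 0.5 * L - 1 := by
      have := Real.log_le_log hy0 hyle
      rwa [Real.log_div hsqrt0.ne' he0.ne', hlogsqrt, Real.log_exp] at this
    exact le_trans (by linarith) (le_abs_self _)
  · have hylt : Real.exp 1 * P ^ (0.5 : ℝ) < y := by
      calc Real.exp 1 * P ^ (0.5 : ℝ) = (l₁ : ℝ) * (Real.exp 1 * N) := by rw [← hNl₁]; ring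
        _ < (l₁ : ℝ) * l := mul_lt_mul_of_pos_left h hl₁0
        _ = y := hyeq.symm
    have : 1 + 0.5 * L < Real.log y := by
      have := Real.log_lt_log (by positivity) hylt
      rwa [Real.log_mul he0.ne' hsqrt0.ne', Real.log_exp, hlogsqrt] at this
    exact le_trans (by linarith) (neg_le_abs _)

/-- **The termwise comparison of (B.3)'s tail with the smoothed series**: for `l ≥ 1`, `y = l₁l`,
`‖f(l) − g(l)‖ ≤ 2‖ϱ‖/l·1_window + c_O‖ϱ‖/l·1[l ≤ P] + (0.004/0.504)P^{−1/2}l^{−3/2}`, where `f(l)` is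
the summand of `seriesB13` and `g(l) = 1[P^{1/2}/l₁ < l]ϰ₁(l₁l)ϱ_j(l)/l` that of `tailB3`.
[cite: Zhang2022LandauSiegel, App. B p.108 (proof of (B.3)); §4 (4.2)–(4.3)] -/
theorem u013_term_bound (c' : ℝ) (D j l₁ l : ℕ) (v : ℝ) (hv : betaJ c' D j = (v : ℂ) * I)
    {P L Λ N : ℝ} (hPdef : P = bigP D) (hlogP' : Real.log P = L) (hL1 : 1 ≤ L) (hP1 : 1 < P)
    (hΛ : Λ = ell D ^ 30) (hΛ9 : 9 ≤ Λ) (hl₁ : 1 ≤ l₁) (hlpos : 0 < l)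
    (hN : N = P ^ (0.5 : ℝ) / l₁) :
    ‖varrhoJ c' D j l / (l : ℂ) * ((Skeleton.P1 D / (l₁ * l : ℕ) : ℝ) : ℂ) ^ beta6 D *
        (((1 / 0.504 : ℝ) : ℂ) * ∫ z in (0.5 : ℝ)..0.504,
          ((gW D (bigP D ^ z / (l₁ * l : ℕ)) - gW D (bigP D ^ (0.5 : ℝ) / (l₁ * l : ℕ)) : ℝ) : ℂ)) -
      (if bigP D ^ (1 / 2 : ℝ) / l₁ < (l : ℝ) then vk1 D (l₁ * l) else 0) * varrhoJ c' D j l / (l : ℂ)‖ ≤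
      (if l ∈ (Finset.Icc 1 ⌊Real.exp 1 * N⌋₊).filter (fun l : ℕ => N / Real.exp 1 < l)
        then 2 * (‖rho v l‖ / l) else 0) +
      (if l ∈ Finset.Icc 1 ⌊P⌋₊
        then (1 / 0.504) * ((1 / 2) * Real.sqrt (π / Λ) / L + 0.002 * rexp (-Λ)) * (‖rho v l‖ / l)
        else 0) +
      (0.004 / 0.504) * P ^ (-(1 / 2) : ℝ) * ((l : ℝ) ^ (3 / 2 : ℝ))⁻¹ := by
  have hP0 : 0 < P := by linarith
  have hL0 : 0 < L := by linarith
  have hΛ0 : 0 < Λ := by linarith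
  have hl₁0 : (0 : ℝ) < l₁ := by exact_mod_cast hl₁
  have hl0 : (0 : ℝ) < l := by exact_mod_cast hlpos
  have hgW : ∀ x, gW D x = gWeight Λ x := fun x => by rw [hΛ]; rfl
  have hρ : ∀ n, varrhoJ c' D j n = rho v n := fun n => rho_eq_sum_of_betaJ hv n
  have hN0 : 0 < N := by rw [hN]; exact div_pos (Real.rpow_pos_of_pos hP0 _) hl₁0
  have heN0 : 0 ≤ Real.exp 1 * N := (mul_pos (Real.exp_pos 1) hN0).le
  have hP1eq : Skeleton.P1 D = P ^ (0.504 : ℝ) := by rw [hPdef]; rfl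
  have hP1gt : 1 < Skeleton.P1 D := by rw [hP1eq]; exact Real.one_lt_rpow hP1 (by norm_num)
  have hP1pos : 0 < Skeleton.P1 D := by linarith
  have hP1le : Skeleton.P1 D ≤ P := by
    rw [hP1eq]
    calc P ^ (0.504 : ℝ) ≤ P ^ (1 : ℝ) := Real.rpow_le_rpow_of_exponent_le hP1.le (by norm_num)
      _ = P := Real.rpow_one P
  -- the point `y = l₁ l`
  obtain ⟨y, hy⟩ : ∃ y : ℝ, y = ((l₁ * l : ℕ) : ℝ) := ⟨_, rfl⟩
  have hyeq : y = (l₁ : ℝ) * l := by rw [hy, Nat.cast_mul]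
  have hly : (l : ℝ) ≤ y := by
    rw [hyeq]
    have : (1 : ℝ) ≤ l₁ := by exact_mod_cast hl₁
    nlinarith
  have hy0 : 0 < y := lt_of_lt_of_le hl0 hly
  -- abbreviations
  obtain ⟨Ir, hIr⟩ : ∃ I₀ : ℝ,
      I₀ = ∫ z in (0.5 : ℝ)..0.504, (gWeight Λ (P ^ z / y) - gWeight Λ (P ^ (0.5 : ℝ) / y)) :=
    ⟨_, rfl⟩
  obtain ⟨w, hw⟩ : ∃ w : ℂ, w = ((Skeleton.P1 D / y : ℝ) : ℂ) ^ beta6 D := ⟨_, rfl⟩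
  obtain ⟨mW, hmW⟩ : ∃ m : ℝ, m =
      ((∫ z in (0.5 : ℝ)..0.504, (Ioi (Real.log y / Real.log P)).indicator (fun _ => (1 : ℝ)) z) -
        0.004 * (if y < P ^ (0.5 : ℝ) then 1 else 0)) := ⟨_, rfl⟩
  obtain ⟨ρ, hρdef⟩ : ∃ ρ : ℂ, ρ = varrhoJ c' D j l / (l : ℂ) := ⟨_, rfl⟩
  have hw1 : ‖w‖ = 1 := by rw [hw]; exact norm_cpow_beta6 D (div_pos hP1pos hy0)
  have hρl : ‖ρ‖ = ‖rho v l‖ / l := by rw [hρdef, norm_div, Complex.norm_natCast, hρ]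
  have hρl1 : ‖rho v l‖ / l ≤ 1 := by rw [← hρl, hρdef]; exact norm_varrhoJ_div_le_one c' D j hlpos
  have hρl0 : 0 ≤ ‖rho v l‖ / l := by positivity
  have hIr_le : |Ir| ≤ 0.004 := by rw [hIr]; exact abs_transition_le hΛ0 _ _
  -- the two terms in closed form
  have hfl : varrhoJ c' D j l / (l : ℂ) * ((Skeleton.P1 D / (l₁ * l : ℕ) : ℝ) : ℂ) ^ beta6 D *
        (((1 / 0.504 : ℝ) : ℂ) * ∫ z in (0.5 : ℝ)..0.504,
          ((gW D (bigP D ^ z / (l₁ * l : ℕ)) - gW D (bigP D ^ (0.5 : ℝ) / (l₁ * l : ℕ)) : ℝ) : ℂ)) =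
      ρ * w * (((1 / 0.504) * Ir : ℝ) : ℂ) := by
    rw [intervalIntegral.integral_ofReal, ← hy, ← hPdef, hρdef, hw, hIr]
    simp only [hgW]
    push_cast
    ring
  have hnorm : ∀ r : ℝ, ‖ρ * w * ((r : ℝ) : ℂ)‖ = ‖rho v l‖ / l * |r| := by
    intro r
    rw [norm_mul, norm_mul, hρl, hw1, mul_one, Complex.norm_real, Real.norm_eq_abs]
  rw [hfl]
  -- nonnegativity of the three pieces
  have hA0 : 0 ≤ (if l ∈ (Finset.Icc 1 ⌊Real.exp 1 * N⌋₊).filter (fun l : ℕ => N / Real.exp 1 < l)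
      then 2 * (‖rho v l‖ / l) else 0) := by split_ifs <;> positivity
  have hB0 : 0 ≤ (if l ∈ Finset.Icc 1 ⌊P⌋₊
      then (1 / 0.504) * ((1 / 2) * Real.sqrt (π / Λ) / L + 0.002 * rexp (-Λ)) * (‖rho v l‖ / l)
      else 0) := by split_ifs <;> positivity
  have hC0 : 0 ≤ (0.004 / 0.504) * P ^ (-(1 / 2) : ℝ) * ((l : ℝ) ^ (3 / 2 : ℝ))⁻¹ := by positivity
  by_cases hlW : l ∈ (Finset.Icc 1 ⌊Real.exp 1 * N⌋₊).filter (fun l : ℕ => N / Real.exp 1 < l)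
  · -- the window: both terms are `≤ ‖ϱ‖/l`
    have h1 : ‖ρ * w * (((1 / 0.504) * Ir : ℝ) : ℂ)‖ ≤ ‖rho v l‖ / l := by
      rw [hnorm]
      calc ‖rho v l‖ / l * |1 / 0.504 * Ir| ≤ ‖rho v l‖ / l * 1 := by
            refine mul_le_mul_of_nonneg_left ?_ hρl0
            rw [abs_mul, abs_of_pos (by norm_num : (0 : ℝ) < 1 / 0.504)]
            calc 1 / 0.504 * |Ir| ≤ 1 / 0.504 * 0.004 := by gcongr
              _ ≤ 1 := by norm_num
        _ = _ := mul_one _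
    have h2 : ‖(if bigP D ^ (1 / 2 : ℝ) / l₁ < (l : ℝ) then vk1 D (l₁ * l) else 0) *
        varrhoJ c' D j l / (l : ℂ)‖ ≤ ‖rho v l‖ / l := by
      rw [mul_div_assoc, ← hρdef, norm_mul, hρl]
      calc _ ≤ 1 * (‖rho v l‖ / l) := by
            refine mul_le_mul_of_nonneg_right ?_ hρl0
            split_ifs
            · exact norm_vk1_le_one D (Nat.mul_pos hl₁ hlpos) hP1gt
            · simp
        _ = _ := one_mul _
    rw [if_pos hlW]
    calc _ ≤ ‖ρ * w * (((1 / 0.504) * Ir : ℝ) : ℂ)‖ +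
          ‖(if bigP D ^ (1 / 2 : ℝ) / l₁ < (l : ℝ) then vk1 D (l₁ * l) else 0) *
            varrhoJ c' D j l / (l : ℂ)‖ := norm_sub_le _ _
      _ ≤ ‖rho v l‖ / l + ‖rho v l‖ / l := add_le_add h1 h2
      _ = 2 * (‖rho v l‖ / l) := by ring
      _ ≤ _ := by linarith
  · -- off the window
    rw [if_neg hlW]
    have hoff : (l : ℝ) ≤ N / Real.exp 1 ∨ Real.exp 1 * N < l := by
      rw [Finset.mem_filter, Finset.mem_Icc] at hlW
      by_cases h : N / Real.exp 1 < l
      · right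
        have h' : ¬ (l ≤ ⌊Real.exp 1 * N⌋₊) := fun h' => hlW ⟨⟨hlpos, h'⟩, h⟩
        exact (Nat.floor_lt heN0).mp (by omega)
      · left; exact not_lt.mp h
    have hmain := vk1_eq_weight D l₁ l hPdef hlogP' hL0 hP1 hl₁ hlpos hy hN hoff
    rw [← hmW, ← hw] at hmain
    have hgl : (if bigP D ^ (1 / 2 : ℝ) / l₁ < (l : ℝ) then vk1 D (l₁ * l) else 0) *
        varrhoJ c' D j l / (l : ℂ) = ρ * w * (((1 / 0.504) * mW : ℝ) : ℂ) := by
      rw [hmain, mul_div_assoc, ← hρdef]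
      ring
    have hdiff : ρ * w * (((1 / 0.504) * Ir : ℝ) : ℂ) - ρ * w * (((1 / 0.504) * mW : ℝ) : ℂ) =
        ρ * w * (((1 / 0.504) * (Ir - mW) : ℝ) : ℂ) := by
      push_cast
      ring
    rw [hgl, hdiff, hnorm]
    by_cases hyP : y < P
    · -- `l₁ l < P`: the transition error off the window
      have hfar := far_of_off l₁ l hlogP' hP1 hl₁ hlpos hy hN hoff
      have herr : |Ir - mW| ≤ (1 / 2) * Real.sqrt (π / Λ) / Real.log P + 0.002 * rexp (-Λ) := by
        rw [hIr, hmW]; exact abs_transition_sub_mainW_le_off hΛ0 hP1 hy0 hfar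
      have hlX : l ∈ Finset.Icc 1 ⌊P⌋₊ := by
        rw [Finset.mem_Icc]
        exact ⟨hlpos, Nat.le_floor (le_trans hly hyP.le)⟩
      rw [if_pos hlX]
      calc ‖rho v l‖ / l * |1 / 0.504 * (Ir - mW)|
          ≤ ‖rho v l‖ / l * ((1 / 0.504) * ((1 / 2) * Real.sqrt (π / Λ) / L + 0.002 * rexp (-Λ))) := by
            refine mul_le_mul_of_nonneg_left ?_ hρl0
            rw [abs_mul, abs_of_pos (by norm_num : (0 : ℝ) < 1 / 0.504), ← hlogP']
            gcongr
        _ = (1 / 0.504) * ((1 / 2) * Real.sqrt (π / Λ) / L + 0.002 * rexp (-Λ)) * (‖rho v l‖ / l) := by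
            ring
        _ ≤ _ := by linarith
    · -- `l₁ l ≥ P`: Gaussian decay
      have hPy : P ≤ y := not_lt.mp hyP
      have hm0 : mW = 0 := by rw [hmW]; exact mainW_eq_zero_of_ge hP1 hPy
      have herr : |Ir - mW| ≤ 0.004 * y ^ (-2 : ℝ) := by
        rw [hIr, hmW]
        exact abs_transition_sub_mainW_le_far hΛ9 (by rw [hlogP']; exact hL1) hP1 hPy
      have hy2 : y ^ (-2 : ℝ) ≤ P ^ (-(1 / 2) : ℝ) * ((l : ℝ) ^ (3 / 2 : ℝ))⁻¹ := by
        rw [show (-2 : ℝ) = -(1 / 2) + -(3 / 2) by norm_num, Real.rpow_add hy0,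
          ← Real.rpow_neg hl0.le]
        refine mul_le_mul ?_ ?_ (by positivity) (by positivity)
        · exact Real.rpow_le_rpow_of_nonpos hP0 hPy (by norm_num)
        · exact Real.rpow_le_rpow_of_nonpos hl0 hly (by norm_num)
      calc ‖rho v l‖ / l * |1 / 0.504 * (Ir - mW)| ≤ 1 * (1 / 0.504 * (0.004 * y ^ (-2 : ℝ))) := by
            refine mul_le_mul hρl1 ?_ (abs_nonneg _) (by norm_num)
            rw [abs_mul, abs_of_pos (by norm_num : (0 : ℝ) < 1 / 0.504)]
            gcongr
        _ = (0.004 / 0.504) * y ^ (-2 : ℝ) := by ring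
        _ ≤ (0.004 / 0.504) * (P ^ (-(1 / 2) : ℝ) * ((l : ℝ) ^ (3 / 2 : ℝ))⁻¹) := by gcongr
        _ = (0.004 / 0.504) * P ^ (-(1 / 2) : ℝ) * ((l : ℝ) ^ (3 / 2 : ℝ))⁻¹ := by ring
        _ ≤ _ := by linarith

end Literature.NumberTheory.LFunctions.Zhang2022.AppendixBVarrho
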